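import Summits.BirchSwinnertonDyer.BirchSwinnertonDyer.Theorems.TeichmullerTwistDescentKOfDualSeparation
import Literature.NumberTheory.EllipticCurves.NewformDualSeparation
import HarnessLib

/-!
# Route `TeichmullerTwistDescent`, crux K `TwistedPeriodLatticeSaturation` (stmt-BirchSwinnertonDyer-25368):
# K, LITERALLY, from modularity and the integral tame-type carrier functional ALONE

Cell `pub/bsd-wall` (D-0145 line route-BirchSwinnertonDyer-TeichmullerTwistDescent, OPEN rev 7), seat `bsd-line-ttd-p1`
(prover 1/2, g24).  THEOREMS ONLY (no definition, no named fact, no `sorry`).  BSD is not proved by this file; K is NOT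
proved by this file: the main theorem is CONDITIONAL, with the route decl `TwistedPeriodLatticeSaturation` verbatim as its
conclusion, and with exactly TWO hypotheses:

* `hnf : exists_isNewformOf` — modularity (the tree's named fact);
* `hcar` — the INTEGRAL TAME-TYPE CARRIER FUNCTIONAL: for a curve `W` of conductor `p²M` (`p ∤ M`, `p ≥ 11`, additive at `p`,
  `E[p]` irreducible, (G)-ordinary, `v_p(Δ_min) ≤ 4`) and its modular parametrisation datum `D`, there are `0 < b`, `2b < p − 1`, a
  `ℤ_p`-linear functional `Ψ` on the spread lattice `Λ_Q(f_D)` of the full-level carrier `H₁(Γ₀(M), ℤ_p[GL₂(ℤ/p)])`,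
  equivariant for the principal series `coordRep(ω̃^{p−1−b}, ω̃^b)`, with image of finite index `p^m` whose reduction has socle
  `⊆ Sym^{2b} ⊗ det^{−b}` (`ReductionSocleLe` over `ℤ/p`).  This is the LOAD-BEARING OPEN INPUT of the line (the item's disprover
  note identifies it with Edixhoven's «case 2» / `p ∤ c_E`).

Everything else the K-line needed is now PROVED in the tree: the Gauss-sum dichotomy (`stub_dichotomy_of_modularity`), the
full-level carrier transfer (`CarrierDatum`), Knapp's presentation of `H₁(Γ₀(N), ℤ)`, the Teichmüller/quadratic-character
dictionary, the torus-orbit telescoping, the Hecke quasi-projector machinery, and — last — RATIONAL MULTIPLICITY ONE in the form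
of dual separation (`Literature.…NewformDualSeparation.exists_dualSeparation_of_isNewformOf`: Atkin–Lehner decomposition + strong
multiplicity one, both tree theorems).
-/

set_option linter.dupNamespace false

noncomputable section

open scoped Pointwise MatrixGroups TensorProduct

open Function CongruenceSubgroup
open Literature.RepresentationTheory.FiniteGroups Literature.RepresentationTheory.FiniteGroups.GL2
  Literature.NumberTheory.EllipticCurves.ModularForms
open Literature.NumberTheory.EllipticCurves (Kato2004.teichmullerChar)
open Literature.NumberTheory.ModularSymbols Literature.NumberTheory.ModularSymbols.FullLevel
open Literature.Algebra.Homology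

namespace Summit.BirchSwinnertonDyer.BirchSwinnertonDyer.Theorems.TeichmullerTwistDescent.KOfCarrierOnly

open WeierstrassCurve Literature.NumberTheory.EllipticCurves
  Summit.BirchSwinnertonDyer.BirchSwinnertonDyer.Theorems.TeichmullerTwistDescent.KOfDualSeparation

/-- **K from modularity and the integral tame-type carrier functional.**  The conclusion is the route decl
`TwistedPeriodLatticeSaturation` VERBATIM; BSD is not proved by this; K is proved CONDITIONALLY on `hnf` (modularity) and `hcar`
(the carrier functional) only.  Proof: `KOfDualSeparation.twistedPeriodLatticeSaturation_of_dualSeparation` with the dual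
separation supplied by the tree theorem `exists_dualSeparation_of_isNewformOf W D.isNewformOf p`.
[cite: AtkinLehner1970, Thm. 4 and Thm. 5] [cite: EdixhovenManin1991, §4] [cite: AshStevens1986, §1 (1.2)–(1.4)]
[cite: EmertonGeeSavitt2015, Lemma 4.1.1] -/
theorem twistedPeriodLatticeSaturation_of_carrierFunctional (hnf : exists_isNewformOf)
    (hcar : ∀ (p M : ℕ) [Fact p.Prime] [NeZero M] [NeZero (p ^ 2 * M)] (hpM : Nat.Coprime p M)
      [Fintype (diagTorus (ZMod p))] [Invertible (Fintype.card (diagTorus (ZMod p)) : ℤ_[p])]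
      (W : WeierstrassCurve ℚ) [W.IsElliptic] [W.IsGloballyMinimal], W.conductorNorm ℤ = p ^ 2 * M →
      ∀ D : ModularParametrizationData W (p ^ 2 * M), 11 ≤ p → Rank1Residual.Addv W p → Rank1Residual.Irr W p →
      Summit.BirchSwinnertonDyer.Rank1Residual.Additive.TypeGOrd W p → padicValInt p W.minimalDiscriminantInt ≤ 4 →
      ∃ (b m : ℕ) (Ψ : spreadLattice ℤ_[p] p M hpM D.f →ₗ[ℤ_[p]] (Option (ZMod p) → ℤ_[p])),
        0 < b ∧ 2 * b < p - 1 ∧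
        IsEquivariantOnSpread ℤ_[p] p M hpM D.f
          (coordRep (Kato2004.teichmullerChar p ^ (p - 1 - b)) (Kato2004.teichmullerChar p ^ b)) Ψ ∧
        (∀ v : Option (ZMod p) → ℤ_[p], (p : ℤ_[p]) ^ m • v ∈ LinearMap.range Ψ) ∧
        ∀ Λ' : Subrepresentation (coordRep (Kato2004.teichmullerChar p ^ (p - 1 - b)) (Kato2004.teichmullerChar p ^ b)),
          Λ'.toSubmodule = LinearMap.range Ψ →
            @ReductionSocleLe p _ (ZMod p) _ _ (PadicInt.toZMod (p := p)).toAlgebra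
              (Kato2004.teichmullerChar p ^ (p - 1 - b)) (Kato2004.teichmullerChar p ^ b) (2 * b) Λ') :
    Summit.BirchSwinnertonDyer.BirchSwinnertonDyer.Theses.TeichmullerTwistDescent.TwistedPeriodLatticeSaturation :=
  twistedPeriodLatticeSaturation_of_dualSeparation hnf
    (fun _ p _ _ W _ _ _ D _ _ => exists_dualSeparation_of_isNewformOf W D.isNewformOf p) hcar

end Summit.BirchSwinnertonDyer.BirchSwinnertonDyer.Theorems.TeichmullerTwistDescent.KOfCarrierOnly
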